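import Mathlib
import Summits.Ventures.PercRepro2.RootPairSep

/-!
# Cut vertices: connections across a cut vertex and the pendant factorisation
(blind cell PercRepro2, mine-2 g21; proofs/MINE2-CUTU.md §10.5; the reductions of the cleared
L-half are in `RootPairSepPendant.lean`).

A cut vertex `c` is a root-pair separation with `a₁ = a₂ = c` (`IsRootPairSep ends c c V₁ V₂`):
`V₁ ∩ V₂ = {c}` and every edge lies inside one side.  Across it a connection from `v ∈ V₂` to
`x ∈ V₁` is a connection `v ↔ c` inside `V₂` followed by `c ↔ x` inside `V₁` (`conn_cut`), and
connections between two vertices of `V₁` live inside `V₁` (`conn_detour`).  When both roots lie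
in `V₁` the event `Q = {a₁ ↮ a₂}` and every connection of a root with a vertex of `V₁` are
determined by the edges of `V₁`, while `γ_v = {v ↔ c inside V₂}` is determined by the edges of
`V₂`, so `P(L_v ∩ X ∩ Q) = P(γ_v) · P(L_c ∩ X ∩ Q)` (`prob_pendant_mul`).
-/

namespace Summit.Ventures.PercRepro2

namespace RootPairSep

open SepPair

section Sep

variable {V : Type*} {E : Type*}

/-- Across a cut vertex `c` (`IsRootPairSep ends c c V₁ V₂`): for `v ∈ V₂` and `x ∈ V₁`,
`v ↔ x` iff `v ↔ c` inside `V₂` and `c ↔ x` inside `V₁`. -/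
lemma conn_cut {ends : E → Sym2 V} {c : V} {V₁ V₂ : Set V}
    (hs : IsRootPairSep ends c c V₁ V₂) [DecidablePred (· ∈ side₁ ends V₁)]
    [DecidablePred (· ∈ (side₁ ends V₁)ᶜ)] {ω : Config E} {v x : V} (hv : v ∈ V₂) (hx : x ∈ V₁) :
    Conn ends ω v x ↔
      Conn ends (restrictTo (side₁ ends V₁)ᶜ ω) v c ∧ Conn ends (restrictTo (side₁ ends V₁) ω) c x := by
  have hc₁ : c ∈ V₁ := hs.a₁_mem.1
  have hcc : ∀ z, z ∈ V₁ → z ∈ V₂ → z = c := by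
    intro z h₁ h₂
    have := hs.inter_sub ⟨h₁, h₂⟩
    simpa using this
  constructor
  · intro h
    let S : Set V := {z | Conn ends (restrictTo (side₁ ends V₁)ᶜ ω) v z ∨
      (Conn ends (restrictTo (side₁ ends V₁)ᶜ ω) v c ∧ Conn ends (restrictTo (side₁ ends V₁) ω) c z)}
    have hvS : v ∈ S := Or.inl (conn_refl _ _ _)
    have hclosed : ∀ e x y, ω e = true → ends e = s(x, y) → x ∈ S → y ∈ S := by
      intro e x y he hends hxS
      by_cases heF : e ∈ side₁ ends V₁
      · have hx₁ : x ∈ V₁ := (heF x y hends).1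
        rcases hxS with h1 | ⟨h2, h3⟩
        · have hx₂ : x ∈ V₂ := reach_side₂ hs hv h1
          have hxc := hcc x hx₁ hx₂
          subst hxc
          exact Or.inr ⟨h1, conn_of_openAdj ⟨e, restrictTo_eq_true_of_mem heF he, hends⟩⟩
        · exact Or.inr ⟨h2, conn_trans h3
            (conn_of_openAdj ⟨e, restrictTo_eq_true_of_mem heF he, hends⟩)⟩
      · have heF' : e ∈ (side₁ ends V₁)ᶜ := heF
        rcases hxS with h1 | ⟨h2, h3⟩
        · exact Or.inl (conn_trans h1
            (conn_of_openAdj ⟨e, restrictTo_eq_true_of_mem heF' he, hends⟩))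
        · have hx₁ : x ∈ V₁ := reach_side₁ hc₁ h3
          have hx₂ : x ∈ V₂ := (mem_side₂_of_not_side₁ hs hends heF).1
          have hxc := hcc x hx₁ hx₂
          subst hxc
          exact Or.inl (conn_trans h2
            (conn_of_openAdj ⟨e, restrictTo_eq_true_of_mem heF' he, hends⟩))
    have hxS : x ∈ S := mem_of_conn_of_closed' (S := S) hclosed hvS h
    rcases hxS with h1 | h2
    · have hx₂ : x ∈ V₂ := reach_side₂ hs hv h1
      have hxc := hcc x hx hx₂
      subst hxc
      exact ⟨h1, conn_refl _ _ _⟩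
    · exact h2
  · rintro ⟨h1, h2⟩
    exact conn_trans (conn_of_conn_restrictTo h1) (conn_of_conn_restrictTo h2)

/-- Across a cut vertex, a connection between two vertices of `V₁` lives inside `V₁`
(an excursion into `V₂` returns through `c`). -/
lemma conn_detour {ends : E → Sym2 V} {c : V} {V₁ V₂ : Set V}
    (hs : IsRootPairSep ends c c V₁ V₂) [DecidablePred (· ∈ side₁ ends V₁)]
    [DecidablePred (· ∈ (side₁ ends V₁)ᶜ)] {ω : Config E} {x y : V} (hx : x ∈ V₁) (hy : y ∈ V₁) :
    Conn ends ω x y ↔ Conn ends (restrictTo (side₁ ends V₁) ω) x y := by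
  have hc₂ : c ∈ V₂ := hs.a₁_mem.2
  have hcc : ∀ z, z ∈ V₁ → z ∈ V₂ → z = c := by
    intro z h₁ h₂
    have := hs.inter_sub ⟨h₁, h₂⟩
    simpa using this
  constructor
  · intro h
    let S : Set V := {z | Conn ends (restrictTo (side₁ ends V₁) ω) x z ∨
      (Conn ends (restrictTo (side₁ ends V₁) ω) x c ∧ Conn ends (restrictTo (side₁ ends V₁)ᶜ ω) c z)}
    have hxS : x ∈ S := Or.inl (conn_refl _ _ _)
    have hclosed : ∀ e x' y', ω e = true → ends e = s(x', y') → x' ∈ S → y' ∈ S := by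
      intro e x' y' he hends hxS'
      by_cases heF : e ∈ side₁ ends V₁
      · rcases hxS' with h1 | ⟨h2, h3⟩
        · exact Or.inl (conn_trans h1
            (conn_of_openAdj ⟨e, restrictTo_eq_true_of_mem heF he, hends⟩))
        · have hx₂ : x' ∈ V₂ := reach_side₂ hs hc₂ h3
          have hx₁ : x' ∈ V₁ := (heF x' y' hends).1
          have hxc := hcc x' hx₁ hx₂
          subst hxc
          exact Or.inl (conn_trans h2
            (conn_of_openAdj ⟨e, restrictTo_eq_true_of_mem heF he, hends⟩))
      · have heF' : e ∈ (side₁ ends V₁)ᶜ := heF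
        rcases hxS' with h1 | ⟨h2, h3⟩
        · have hx₁ : x' ∈ V₁ := reach_side₁ hx h1
          have hx₂ : x' ∈ V₂ := (mem_side₂_of_not_side₁ hs hends heF).1
          have hxc := hcc x' hx₁ hx₂
          subst hxc
          exact Or.inr ⟨h1, conn_of_openAdj ⟨e, restrictTo_eq_true_of_mem heF' he, hends⟩⟩
        · exact Or.inr ⟨h2, conn_trans h3
            (conn_of_openAdj ⟨e, restrictTo_eq_true_of_mem heF' he, hends⟩)⟩
    have hyS : y ∈ S := mem_of_conn_of_closed' (S := S) hclosed hxS h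
    rcases hyS with h1 | ⟨h2, h3⟩
    · exact h1
    · have hy₂ : y ∈ V₂ := reach_side₂ hs hc₂ h3
      have hyc := hcc y hy hy₂
      subst hyc
      exact h2
  · intro h
    exact conn_of_conn_restrictTo h

end Sep

section Prob

variable {V : Type*} {E : Type*} [Fintype E] [DecidableEq E] {R : Type*} [CommRing R]

/-- **Pendant factorisation.**  If `c` is a cut vertex with both roots in `V₁`, `v ∈ V₂`, and
`X ∩ Q` is determined by the edges of `V₁` (on `Q` or not), then
`P(L_v ∩ X ∩ Q) = P(γ_v) · P(L_c ∩ X ∩ Q)` with `γ_v = {v ↔ c inside V₂}`. -/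
theorem prob_pendant_mul (p : E → R) {ends : E → Sym2 V} {c a₁ : V} {V₁ V₂ : Set V}
    (hs : IsRootPairSep ends c c V₁ V₂) [DecidablePred (· ∈ side₁ ends V₁)]
    [DecidablePred (· ∈ (side₁ ends V₁)ᶜ)] (ha₁ : a₁ ∈ V₁) {v : V} (hv : v ∈ V₂)
    {Y : Set (Config E)} (hY : ∀ ω, ω ∈ Y ↔ restrictTo (side₁ ends V₁) ω ∈ Y) :
    prob p (connEvent ends a₁ v ∩ Y) =
      prob p (restrictTo (side₁ ends V₁)ᶜ ⁻¹' connEvent ends v c) *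
        prob p (connEvent ends a₁ c ∩ Y) := by
  have hc₁ : c ∈ V₁ := hs.a₁_mem.1
  have ind : ∀ A B : Set (Config E),
      prob p (restrictTo (side₁ ends V₁)ᶜ ⁻¹' A ∩ restrictTo (side₁ ends V₁) ⁻¹' B) =
        prob p (restrictTo (side₁ ends V₁)ᶜ ⁻¹' A) * prob p (restrictTo (side₁ ends V₁) ⁻¹' B) :=
    fun A B => prob_inter_eq_mul_of_dependsOn p disjoint_compl_left
      (dependsOn_restrictTo _ A) (dependsOn_restrictTo _ B)
  have e : connEvent ends a₁ v ∩ Y =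
      restrictTo (side₁ ends V₁)ᶜ ⁻¹' connEvent ends v c ∩
        restrictTo (side₁ ends V₁) ⁻¹' (connEvent ends a₁ c ∩ Y) := by
    ext ω
    have h1 : Conn ends ω a₁ v ↔ Conn ends ω v a₁ := ⟨conn_symm, conn_symm⟩
    have h2 := conn_cut hs (ω := ω) hv ha₁
    have h3 : Conn ends (restrictTo (side₁ ends V₁) ω) c a₁ ↔
        Conn ends (restrictTo (side₁ ends V₁) ω) a₁ c := ⟨conn_symm, conn_symm⟩
    have h4 := conn_detour hs (ω := ω) ha₁ hc₁
    have h5 := hY ω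
    simp only [Set.mem_inter_iff, Set.mem_preimage]
    change (Conn ends ω a₁ v ∧ ω ∈ Y) ↔ Conn ends (restrictTo (side₁ ends V₁)ᶜ ω) v c ∧
      (Conn ends (restrictTo (side₁ ends V₁) ω) a₁ c ∧ restrictTo (side₁ ends V₁) ω ∈ Y)
    tauto
  have e' : connEvent ends a₁ c ∩ Y = restrictTo (side₁ ends V₁) ⁻¹' (connEvent ends a₁ c ∩ Y) := by
    ext ω
    have h4 := conn_detour hs (ω := ω) ha₁ hc₁
    have h5 := hY ω
    simp only [Set.mem_inter_iff, Set.mem_preimage]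
    change (Conn ends ω a₁ c ∧ ω ∈ Y) ↔
      (Conn ends (restrictTo (side₁ ends V₁) ω) a₁ c ∧ restrictTo (side₁ ends V₁) ω ∈ Y)
    tauto
  rw [e, ind, ← e']

end Prob

end RootPairSep

end Summit.Ventures.PercRepro2
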